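import Mathlib
import Literature.Analysis.Calculus.PoincareLemmaOneFormStarConvex
import Literature.Analysis.FluidPDE.VorticityCalculus
import Literature.Analysis.FluidPDE.BiotSavartCurlPair
import Literature.Analysis.FluidPDE.WholeSpaceIBP
import Summits.NavierStokesRegularity.NavierStokesRegularity.Theorems.EulerZoomLiouvillePowerGaugeEulerLiouvilleSelfSimilarVorticity
import HarnessLib

/-!
# Crux `PoloidalLiouville` (stmt-NavierStokesRegularity-1222, wall W1), crux idea «steady-centre-sieve» (ns-idea-15 g5,
# `Cruxes/PoloidalLiouville/CentreJetSketch.lean`): the POLOIDAL VELOCITY REPRESENTATION (E4), body VERBATIM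

Support file (Theorems-side; seat ns-wall-eng-7 g5, cell ns-wall-extremal, W1 adjunct; `--supports
stmt-NavierStokesRegularity-1222 --as helper`).  (E4, S) of the steady centre-jet sieve — the Poincaré-lemma step of the card:
a `C²` divergence-free field `V` on `ℝ³` whose vorticity is TOROIDAL-EXACT off a point `x₀`,
`curl V = ∇T × (x − x₀)` with `T ∈ C²(ℝ³ ∖ {x₀})`, is `V = T·(x − x₀) + ∇φ` off `x₀` for some `φ ∈ C²(ℝ³ ∖ {x₀})`, and then
`div V = 0` reads `Δφ = −(3T + ⟪x − x₀, ∇T⟫)` off `x₀`.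

Proof.  `W := V − T·(· − x₀)` is curl-free on the open set `{x₀}ᶜ` (`curl (T y) = ∇T × y`, the Leibniz rule `curl_smul` and
`curlCLM_smulRight`), so its Jacobian is symmetric there (tree `PowerGaugeEulerLiouville.inner_fderiv_comm_of_curl_eq_zero`) and the `1`-form
`A = ⟪W, ·⟫` is closed.  The TREE's Poincaré lemma for
closed `1`-forms on OPEN STAR-SHAPED sets (`Literature.Analysis.Calculus.hasFDerivAt_radialIntegral_of_starConvex`, Spivak 4-11)
gives potentials `u±` on the two charts `U± = ℝ³ ∖ {x₀ ± s e₃ : s ≥ 0}` (each star-shaped about the opposite axis point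
`x₀ ∓ e₃`), which cover `ℝ³ ∖ {x₀}`; on the overlap `U₊ ∩ U₋ = ℝ³ ∖ (x₀ + ℝ e₃)` — preconnected, being the union of the four
open half-spaces `{±(x − x₀)₀ > 0}`, `{±(x − x₀)₁ > 0}` chained through common points — `∇(u₊ − u₋) = 0`, so the two differ by a
constant (`IsOpen.exists_eq_add_of_fderiv_eq`) and glue to one `φ` with `Dφ = ⟪W, ·⟫` on `{x₀}ᶜ`.  Regularity and the Laplacian
clause are then local: `Dφ = ⟪W, ·⟫` with `W ∈ C¹` on the open set, and `Δφ = Σᵢ ⟪DW eᵢ, eᵢ⟫ = div W = div V − div (T·(x − x₀))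
= 0 − (3T + ⟪x − x₀, ∇T⟫)` (`divergence_sub_apply`, `divergence_smul_apply`).

* `CentreJet.poloidalRepresentation` — body of the sketch's `PoloidalRepresentation` (v1.3, with the `Δφ` clause) verbatim.

HONEST LABEL: vector calculus (Poincaré lemma on the simply connected `ℝ³ ∖ {x₀}`) about typed objects of one crux idea; the card's
conjectures and target, `PoloidalLiouville` (1222) and NS regularity remain OPEN and untouched; information-grade (movement 0).
[cite: Spivak1965, Thm. 4-11] [cite: MajdaBertozziCUP2002, §1.1 (vector identities)]
-/

-- the summit and its single problem share the name (D-0017 nested layout)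
set_option linter.dupNamespace false

noncomputable section

open Set Function Filter
open scoped RealInnerProductSpace Topology
open Literature.Analysis.FluidPDE

namespace Summit.NavierStokesRegularity.NavierStokesRegularity.Theorems.PoloidalLiouville.CentreJet

/-! ### Curl-free fields: symmetric Jacobian, the closed `1`-form `⟪W, ·⟫`, potentials on star-shaped open sets -/

/-- **Scalar potential on a star-shaped open set.**  A `C¹` curl-free field `W` on an open set `s ⊆ ℝ³` star-shaped about `b` is
a gradient there: the radial integral `u(y) = ∫₀¹ ⟪W(b + t(y − b)), y − b⟫ dt` has `Du(z) = ⟪W(z), ·⟫` at every `z ∈ s`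
(the tree's Poincaré lemma for closed `1`-forms, `hasFDerivAt_radialIntegral_of_starConvex`, applied to `A = ⟪W, ·⟫`, whose
derivative `⟪DW v, w⟫` is symmetric because `curl W = 0`). -/
theorem exists_hasFDerivAt_innerSL_of_curl_eq_zero_of_starConvex
    {W : EuclideanSpace ℝ (Fin 3) → EuclideanSpace ℝ (Fin 3)} {s : Set (EuclideanSpace ℝ (Fin 3))} {b : EuclideanSpace ℝ (Fin 3)}
    (hso : IsOpen s) (hs : StarConvex ℝ b s) (hW : ContDiffOn ℝ 1 W s) (hcurl : ∀ z ∈ s, curl W z = 0) :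
    ∃ u : EuclideanSpace ℝ (Fin 3) → ℝ, ∀ z ∈ s, HasFDerivAt u (innerSL ℝ (W z)) z := by
  have hA : ContDiffOn ℝ 1 (fun z => innerSL ℝ (W z)) s :=
    (innerSL ℝ (E := EuclideanSpace ℝ (Fin 3))).contDiff.comp_contDiffOn hW
  have hsymm : ∀ z ∈ s, ∀ v w : EuclideanSpace ℝ (Fin 3),
      fderiv ℝ (fun z => innerSL ℝ (W z)) z v w = fderiv ℝ (fun z => innerSL ℝ (W z)) z w v := by
    intro z hz v w
    have hWd : DifferentiableAt ℝ W z := (hW.differentiableOn one_ne_zero).differentiableAt (hso.mem_nhds hz)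
    have hD : HasFDerivAt (fun z => innerSL ℝ (W z))
        ((innerSL ℝ (E := EuclideanSpace ℝ (Fin 3))).comp (fderiv ℝ W z)) z :=
      (innerSL ℝ (E := EuclideanSpace ℝ (Fin 3))).hasFDerivAt.comp z hWd.hasFDerivAt
    rw [hD.fderiv]
    simp only [ContinuousLinearMap.comp_apply, innerSL_apply_apply]
    exact PowerGaugeEulerLiouville.inner_fderiv_comm_of_curl_eq_zero hWd (hcurl z hz) v w
  exact ⟨fun y => ∫ t in (0 : ℝ)..1, (innerSL ℝ (W (b + t • (y - b)))) (y - b), fun z hz =>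
    Literature.Analysis.Calculus.hasFDerivAt_radialIntegral_of_starConvex hso hs hA hsymm hz⟩

/-- **Gluing two potentials across a preconnected overlap.**  If a continuous-linear-form field `A` has potentials on two
open sets whose intersection is preconnected, it has one on the union (the difference of the two potentials has zero
derivative on the overlap, hence is constant there, `IsOpen.exists_eq_add_of_fderiv_eq`). -/
theorem exists_hasFDerivAt_of_union {A : EuclideanSpace ℝ (Fin 3) → EuclideanSpace ℝ (Fin 3) →L[ℝ] ℝ}
    {s₁ s₂ : Set (EuclideanSpace ℝ (Fin 3))} (h₁ : IsOpen s₁) (h₂ : IsOpen s₂) (hconn : IsPreconnected (s₁ ∩ s₂))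
    (hu₁ : ∃ u : EuclideanSpace ℝ (Fin 3) → ℝ, ∀ z ∈ s₁, HasFDerivAt u (A z) z)
    (hu₂ : ∃ u : EuclideanSpace ℝ (Fin 3) → ℝ, ∀ z ∈ s₂, HasFDerivAt u (A z) z) :
    ∃ u : EuclideanSpace ℝ (Fin 3) → ℝ, ∀ z ∈ s₁ ∪ s₂, HasFDerivAt u (A z) z := by
  classical
  obtain ⟨u₁, hu₁⟩ := hu₁
  obtain ⟨u₂, hu₂⟩ := hu₂
  have hd₁ : DifferentiableOn ℝ u₁ (s₁ ∩ s₂) := fun z hz => (hu₁ z hz.1).differentiableAt.differentiableWithinAt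
  have hd₂ : DifferentiableOn ℝ u₂ (s₁ ∩ s₂) := fun z hz => (hu₂ z hz.2).differentiableAt.differentiableWithinAt
  have hfd : (s₁ ∩ s₂).EqOn (fderiv ℝ u₁) (fderiv ℝ u₂) := fun z hz => by
    rw [(hu₁ z hz.1).fderiv, (hu₂ z hz.2).fderiv]
  obtain ⟨a, ha⟩ := (h₁.inter h₂).exists_eq_add_of_fderiv_eq hconn hd₁ hd₂ hfd
  refine ⟨fun z => if z ∈ s₁ then u₁ z else u₂ z + a, fun z hz => ?_⟩
  by_cases hz₁ : z ∈ s₁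
  · have hev : (fun z => if z ∈ s₁ then u₁ z else u₂ z + a) =ᶠ[𝓝 z] u₁ := by
      filter_upwards [h₁.mem_nhds hz₁] with y hy
      rw [if_pos hy]
    exact (hu₁ z hz₁).congr_of_eventuallyEq hev
  · have hz₂ : z ∈ s₂ := hz.resolve_left hz₁
    have hev : (fun z => if z ∈ s₁ then u₁ z else u₂ z + a) =ᶠ[𝓝 z] fun y => u₂ y + a := by
      filter_upwards [h₂.mem_nhds hz₂] with y hy
      by_cases hy₁ : y ∈ s₁
      · rw [if_pos hy₁, ha ⟨hy₁, hy⟩]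
      · rw [if_neg hy₁]
    exact ((hu₂ z hz₂).add_const a).congr_of_eventuallyEq hev

/-! ### The two star-shaped charts of `ℝ³ ∖ {x₀}` and their overlap -/

/-- The closed half-axis `{x₀ + s e₃ : σ s ≥ 0}` (`σ = ±1`) is closed. -/
theorem isClosed_axisRay (x₀ : EuclideanSpace ℝ (Fin 3)) (σ : ℝ) :
    IsClosed {x : EuclideanSpace ℝ (Fin 3) | (x - x₀) 0 = 0 ∧ (x - x₀) 1 = 0 ∧ 0 ≤ σ * (x - x₀) 2} := by
  have hc : ∀ i : Fin 3, Continuous fun x : EuclideanSpace ℝ (Fin 3) => (x - x₀) i := fun i =>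
    (PiLp.continuous_apply 2 (fun _ : Fin 3 => ℝ) i).comp (continuous_id.sub continuous_const)
  exact (isClosed_eq (hc 0) continuous_const).inter
    ((isClosed_eq (hc 1) continuous_const).inter (isClosed_le continuous_const (continuous_const.mul (hc 2))))

/-- The complement of the closed half-axis `{x₀ + s e₃ : σ s ≥ 0}` (`σ ≠ 0`) is star-shaped about the opposite axis point
`x₀ − σ e₃`: a segment from `x₀ − σ e₃` meeting the half-axis starts on the axis line, hence lies on it, and then its far
endpoint is on the half-axis too. -/
theorem starConvex_compl_axisRay (x₀ : EuclideanSpace ℝ (Fin 3)) {σ : ℝ} (hσ : σ ≠ 0) :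
    StarConvex ℝ (x₀ - σ • EuclideanSpace.single (2 : Fin 3) (1 : ℝ))
      {x : EuclideanSpace ℝ (Fin 3) | (x - x₀) 0 = 0 ∧ (x - x₀) 1 = 0 ∧ 0 ≤ σ * (x - x₀) 2}ᶜ := by
  intro y hy a c ha hc hac
  have hσ2 : 0 < σ ^ 2 := by positivity
  simp only [mem_compl_iff, mem_setOf_eq, not_and, not_le, PiLp.add_apply, PiLp.sub_apply, PiLp.smul_apply,
    EuclideanSpace.single, PiLp.single_apply, smul_eq_mul] at hy ⊢
  simp only [Fin.isValue, show ((0 : Fin 3) = 2) = False by decide, show ((1 : Fin 3) = 2) = False by decide,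
    if_false, if_true, mul_zero, sub_zero, mul_one]
  have ha' : a = 1 - c := by linarith
  subst ha'
  intro h0 h1
  -- `c (y − x₀)₀ = 0` and `c (y − x₀)₁ = 0`
  have h0' : c * (y 0 - x₀ 0) = 0 := by linarith
  have h1' : c * (y 1 - x₀ 1) = 0 := by linarith
  rcases eq_or_ne c 0 with hc0 | hc0
  · subst hc0
    nlinarith
  · have hy0 : y 0 - x₀ 0 = 0 := by
      rcases mul_eq_zero.1 h0' with h | h
      · exact absurd h hc0
      · exact h
    have hy1 : y 1 - x₀ 1 = 0 := by
      rcases mul_eq_zero.1 h1' with h | h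
      · exact absurd h hc0
      · exact h
    have hy2 : σ * (y 2 - x₀ 2) < 0 := hy hy0 hy1
    have hcpos : 0 < c := lt_of_le_of_ne hc (Ne.symm hc0)
    nlinarith [mul_pos hcpos (neg_pos.2 hy2), mul_nonneg ha hσ2.le]

/-- The two chart complements cover `ℝ³ ∖ {x₀}`: a point on both closed half-axes is `x₀`. -/
theorem mem_union_compl_axisRay {x₀ x : EuclideanSpace ℝ (Fin 3)} (hx : x ≠ x₀) :
    x ∈ {x : EuclideanSpace ℝ (Fin 3) | (x - x₀) 0 = 0 ∧ (x - x₀) 1 = 0 ∧ 0 ≤ (1 : ℝ) * (x - x₀) 2}ᶜ ∪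
      {x : EuclideanSpace ℝ (Fin 3) | (x - x₀) 0 = 0 ∧ (x - x₀) 1 = 0 ∧ 0 ≤ (-1 : ℝ) * (x - x₀) 2}ᶜ := by
  by_contra h
  simp only [mem_union, mem_compl_iff, mem_setOf_eq, not_or, not_not] at h
  obtain ⟨⟨h0, h1, h2⟩, ⟨-, -, h2'⟩⟩ := h
  apply hx
  rw [← sub_eq_zero]
  ext i
  fin_cases i
  · simpa using h0
  · simpa using h1
  · simp only [Fin.reduceFinMk, PiLp.zero_apply]
    linarith

/-- The overlap of the two charts is the complement of the axis LINE through `x₀`. -/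
theorem inter_compl_axisRay_eq (x₀ : EuclideanSpace ℝ (Fin 3)) :
    {x : EuclideanSpace ℝ (Fin 3) | (x - x₀) 0 = 0 ∧ (x - x₀) 1 = 0 ∧ 0 ≤ (1 : ℝ) * (x - x₀) 2}ᶜ ∩
      {x : EuclideanSpace ℝ (Fin 3) | (x - x₀) 0 = 0 ∧ (x - x₀) 1 = 0 ∧ 0 ≤ (-1 : ℝ) * (x - x₀) 2}ᶜ =
    {x : EuclideanSpace ℝ (Fin 3) | x₀ 0 < x 0} ∪ {x | x₀ 1 < x 1} ∪ {x | x 0 < x₀ 0} ∪ {x | x 1 < x₀ 1} := by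
  ext x
  simp only [mem_inter_iff, mem_compl_iff, mem_setOf_eq, mem_union, PiLp.sub_apply, one_mul, neg_one_mul, not_and, not_le]
  constructor
  · rintro ⟨h₁, h₂⟩
    by_contra hne
    simp only [not_or, not_lt] at hne
    obtain ⟨⟨⟨ha, hb⟩, hc⟩, hd⟩ := hne
    have e0 : x 0 - x₀ 0 = 0 := by linarith
    have e1 : x 1 - x₀ 1 = 0 := by linarith
    have := h₁ e0 e1
    have := h₂ e0 e1
    linarith
  · intro h
    refine ⟨fun e0 e1 => ?_, fun e0 e1 => ?_⟩ <;>
    · rcases h with ((h | h) | h) | h <;> linarith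

/-- An open half-space `{x | a < x i}` or `{x | x i < a}` of `ℝ³` is preconnected (convex). -/
theorem isPreconnected_halfSpace (i : Fin 3) (a : ℝ) :
    IsPreconnected {x : EuclideanSpace ℝ (Fin 3) | a < x i} ∧ IsPreconnected {x : EuclideanSpace ℝ (Fin 3) | x i < a} := by
  have hlin : IsLinearMap ℝ fun x : EuclideanSpace ℝ (Fin 3) => x i :=
    ⟨fun x y => by simp, fun c x => by simp⟩
  exact ⟨(convex_halfSpace_gt hlin a).isPreconnected, (convex_halfSpace_lt hlin a).isPreconnected⟩

/-- The complement of the axis line through `x₀` is preconnected: it is the union of four convex open half-spaces, consecutive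
ones sharing a point. -/
theorem isPreconnected_compl_axisLine (x₀ : EuclideanSpace ℝ (Fin 3)) :
    IsPreconnected ({x : EuclideanSpace ℝ (Fin 3) | x₀ 0 < x 0} ∪ {x | x₀ 1 < x 1} ∪ {x | x 0 < x₀ 0} ∪ {x | x 1 < x₀ 1}) := by
  set e0 : EuclideanSpace ℝ (Fin 3) := EuclideanSpace.single 0 1 with he0
  set e1 : EuclideanSpace ℝ (Fin 3) := EuclideanSpace.single 1 1 with he1
  have hA := (isPreconnected_halfSpace 0 (x₀ 0)).1
  have hB := (isPreconnected_halfSpace 1 (x₀ 1)).1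
  have hC := (isPreconnected_halfSpace 0 (x₀ 0)).2
  have hD := (isPreconnected_halfSpace 1 (x₀ 1)).2
  have h1 : IsPreconnected ({x : EuclideanSpace ℝ (Fin 3) | x₀ 0 < x 0} ∪ {x | x₀ 1 < x 1}) := by
    refine IsPreconnected.union (x₀ + e0 + e1) ?_ ?_ hA hB <;>
      simp [he0, he1]
  have h2 : IsPreconnected ({x : EuclideanSpace ℝ (Fin 3) | x₀ 0 < x 0} ∪ {x | x₀ 1 < x 1} ∪ {x | x 0 < x₀ 0}) := by
    refine IsPreconnected.union (x₀ - e0 + e1) ?_ ?_ h1 hC <;>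
      simp [he0, he1]
  refine IsPreconnected.union (x₀ - e0 - e1) ?_ ?_ h2 hD <;>
    simp [he0, he1]

/-! ### Vector-calculus identities for `T·(x − x₀)` -/

/-- **`curl (T·(x − x₀)) = ∇T × (x − x₀)`** at a point of differentiability of `T` (Leibniz rule; `curl (x − x₀) = 0`). -/
theorem curl_smul_sub_const {T : EuclideanSpace ℝ (Fin 3) → ℝ} {x₀ x : EuclideanSpace ℝ (Fin 3)}
    (hT : DifferentiableAt ℝ T x) :
    curl (fun y => T y • (y - x₀)) x = cross (gradient T x) (x - x₀) := by
  have hid : DifferentiableAt ℝ (fun y : EuclideanSpace ℝ (Fin 3) => y - x₀) x :=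
    differentiableAt_id.sub (differentiableAt_const x₀)
  -- the identity Jacobian has no axial vector (cf. `DefectColumnGate.curlCLM_id`)
  have hI : curlCLM (ContinuousLinearMap.id ℝ (EuclideanSpace ℝ (Fin 3))) = 0 := by
    ext i
    fin_cases i <;> simp [curlCLM, curlLM]
  rw [curl_smul hT hid, curl_eq_curlCLM (fun y : EuclideanSpace ℝ (Fin 3) => y - x₀), fderiv_sub_const, fderiv_fun_id,
    hI, smul_zero, zero_add, fderiv_eq_innerSL_gradient, curlCLM_smulRight_innerSL]

/-- **`div (T·(x − x₀)) = 3T + ⟪x − x₀, ∇T⟫`** at a point of differentiability of `T`. -/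
theorem divergence_smul_sub_const {T : EuclideanSpace ℝ (Fin 3) → ℝ} {x₀ x : EuclideanSpace ℝ (Fin 3)}
    (hT : DifferentiableAt ℝ T x) :
    VectorCalculus.divergence (fun y => T y • (y - x₀)) x = 3 * T x + ⟪x - x₀, gradient T x⟫ := by
  have hid : DifferentiableAt ℝ (fun y : EuclideanSpace ℝ (Fin 3) => y - x₀) x :=
    differentiableAt_id.sub (differentiableAt_const x₀)
  have hdiv : VectorCalculus.divergence (fun y : EuclideanSpace ℝ (Fin 3) => y - x₀) x = 3 := by
    rw [VectorCalculus.divergence, fderiv_sub_const, fderiv_fun_id]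
    simp [LinearMap.trace_id]
  rw [divergence_smul_apply hT hid, hdiv]
  ring

/-! ### Local regularity and the Laplacian of a potential with prescribed gradient field -/

/-- If `Dφ = ⟪W, ·⟫` on an open set where `W ∈ C¹`, then `φ ∈ C²` there. -/
theorem contDiffOn_two_of_hasFDerivAt_innerSL {φ : EuclideanSpace ℝ (Fin 3) → ℝ}
    {W : EuclideanSpace ℝ (Fin 3) → EuclideanSpace ℝ (Fin 3)} {s : Set (EuclideanSpace ℝ (Fin 3))} (hs : IsOpen s)
    (hW : ContDiffOn ℝ 1 W s) (hφ : ∀ z ∈ s, HasFDerivAt φ (innerSL ℝ (W z)) z) : ContDiffOn ℝ 2 φ s := by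
  rw [show (2 : WithTop ℕ∞) = 1 + 1 from rfl, contDiffOn_succ_iff_fderiv_of_isOpen hs]
  refine ⟨fun z hz => (hφ z hz).differentiableAt.differentiableWithinAt, by simp, ?_⟩
  exact ((innerSL ℝ (E := EuclideanSpace ℝ (Fin 3))).contDiff.comp_contDiffOn hW).congr fun z hz => (hφ z hz).fderiv

/-- If `Dφ = ⟪W, ·⟫` near `x` with `W` differentiable at `x`, then `Δφ(x) = div W (x)` (`Δφ = Σᵢ D²φ(eᵢ, eᵢ) = Σᵢ ⟪DW eᵢ, eᵢ⟫`). -/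
theorem laplacian_eq_divergence_of_hasFDerivAt_innerSL {φ : EuclideanSpace ℝ (Fin 3) → ℝ}
    {W : EuclideanSpace ℝ (Fin 3) → EuclideanSpace ℝ (Fin 3)} {s : Set (EuclideanSpace ℝ (Fin 3))} (hs : IsOpen s)
    (hφ : ∀ z ∈ s, HasFDerivAt φ (innerSL ℝ (W z)) z) {x : EuclideanSpace ℝ (Fin 3)} (hx : x ∈ s)
    (hW : DifferentiableAt ℝ W x) :
    Laplacian.laplacian φ x = VectorCalculus.divergence W x := by
  have hev : fderiv ℝ φ =ᶠ[𝓝 x] fun z => innerSL ℝ (W z) := by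
    filter_upwards [hs.mem_nhds hx] with z hz
    exact (hφ z hz).fderiv
  have hD : HasFDerivAt (fun z => innerSL ℝ (W z))
      ((innerSL ℝ (E := EuclideanSpace ℝ (Fin 3))).comp (fderiv ℝ W x)) x :=
    (innerSL ℝ (E := EuclideanSpace ℝ (Fin 3))).hasFDerivAt.comp x hW.hasFDerivAt
  have h2 : fderiv ℝ (fderiv ℝ φ) x = (innerSL ℝ (E := EuclideanSpace ℝ (Fin 3))).comp (fderiv ℝ W x) := by
    rw [hev.fderiv_eq, hD.fderiv]
  rw [congrFun (InnerProductSpace.laplacian_eq_iteratedFDeriv_orthonormalBasis φ (EuclideanSpace.basisFun (Fin 3) ℝ)) x,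
    divergence_eq_sum_inner_fderiv (EuclideanSpace.basisFun (Fin 3) ℝ)]
  refine Finset.sum_congr rfl fun i _ => ?_
  rw [iteratedFDeriv_two_apply, h2]
  simp only [Matrix.cons_val_zero, Matrix.cons_val_one, ContinuousLinearMap.comp_apply, innerSL_apply_apply]
  exact real_inner_comm _ _

/-! ### Assembly -/

/-- ★ **(E4) `PoloidalRepresentation`, body verbatim** (Poincaré lemma on `ℝ³ ∖ {x₀}`): a `C²` divergence-free field with
toroidal-exact vorticity `curl V = ∇T × (x − x₀)` off `x₀` is `V = T·(x − x₀) + ∇φ` off `x₀`, with `φ ∈ C²(ℝ³ ∖ {x₀})` and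
`Δφ = −(3T + ⟪x − x₀, ∇T⟫)` there. -/
theorem poloidalRepresentation :
    ∀ (V : EuclideanSpace ℝ (Fin 3) → EuclideanSpace ℝ (Fin 3)) (T : EuclideanSpace ℝ (Fin 3) → ℝ)
      (x₀ : EuclideanSpace ℝ (Fin 3)), ContDiff ℝ 2 V → VectorCalculus.IsDivFree V → ContDiffOn ℝ 2 T {x₀}ᶜ →
      (∀ x, x ≠ x₀ → curl V x = cross (gradient T x) (x - x₀)) →
      ∃ φ : EuclideanSpace ℝ (Fin 3) → ℝ, ContDiffOn ℝ 2 φ {x₀}ᶜ ∧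
        (∀ x, x ≠ x₀ → V x = T x • (x - x₀) + gradient φ x) ∧
        ∀ x, x ≠ x₀ → Laplacian.laplacian φ x = -(3 * T x + inner ℝ (x - x₀) (gradient T x)) := by
  intro V T x₀ hV hdiv hT hcurl
  -- the curl-free field `W = V − T·(x − x₀)` on `{x₀}ᶜ`
  set W : EuclideanSpace ℝ (Fin 3) → EuclideanSpace ℝ (Fin 3) := fun y => V y - T y • (y - x₀) with hW_def
  have hopen : IsOpen ({x₀}ᶜ : Set (EuclideanSpace ℝ (Fin 3))) := isOpen_compl_singleton
  have hTd : ∀ x, x ≠ x₀ → DifferentiableAt ℝ T x := fun x hx =>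
    (hT.contDiffAt (hopen.mem_nhds hx)).differentiableAt (by norm_num)
  have hVd : ∀ x, DifferentiableAt ℝ V x := fun x => hV.differentiable (by norm_num) x
  have hTyd : ∀ x, x ≠ x₀ → DifferentiableAt ℝ (fun y => T y • (y - x₀)) x := fun x hx =>
    (hTd x hx).smul (differentiableAt_id.sub (differentiableAt_const x₀))
  have hW2 : ContDiffOn ℝ 2 W {x₀}ᶜ :=
    hV.contDiffOn.sub (hT.smul (contDiffOn_id.sub contDiffOn_const))
  have hW1 : ContDiffOn ℝ 1 W {x₀}ᶜ := hW2.of_le (by norm_num)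
  have hWd : ∀ x, x ≠ x₀ → DifferentiableAt ℝ W x := fun x hx =>
    (hW1.contDiffAt (hopen.mem_nhds hx)).differentiableAt one_ne_zero
  have hWcurl : ∀ x ∈ ({x₀}ᶜ : Set (EuclideanSpace ℝ (Fin 3))), curl W x = 0 := by
    intro x hx
    have hx' : x ≠ x₀ := hx
    rw [hW_def, curl_sub (hVd x) (hTyd x hx'), curl_smul_sub_const (hTd x hx'), hcurl x hx', sub_self]
  -- the two charts
  set R₁ := {x : EuclideanSpace ℝ (Fin 3) | (x - x₀) 0 = 0 ∧ (x - x₀) 1 = 0 ∧ 0 ≤ (1 : ℝ) * (x - x₀) 2} with hR₁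
  set R₂ := {x : EuclideanSpace ℝ (Fin 3) | (x - x₀) 0 = 0 ∧ (x - x₀) 1 = 0 ∧ 0 ≤ (-1 : ℝ) * (x - x₀) 2} with hR₂
  have hx₀R₁ : x₀ ∈ R₁ := by simp [hR₁]
  have hx₀R₂ : x₀ ∈ R₂ := by simp [hR₂]
  have hR₁s : R₁ᶜ ⊆ {x₀}ᶜ := compl_subset_compl.2 (singleton_subset_iff.2 hx₀R₁)
  have hR₂s : R₂ᶜ ⊆ {x₀}ᶜ := compl_subset_compl.2 (singleton_subset_iff.2 hx₀R₂)
  have ho₁ : IsOpen R₁ᶜ := (isClosed_axisRay x₀ 1).isOpen_compl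
  have ho₂ : IsOpen R₂ᶜ := (isClosed_axisRay x₀ (-1)).isOpen_compl
  have hst₁ : StarConvex ℝ (x₀ - (1 : ℝ) • EuclideanSpace.single (2 : Fin 3) (1 : ℝ)) R₁ᶜ :=
    starConvex_compl_axisRay x₀ one_ne_zero
  have hst₂ : StarConvex ℝ (x₀ - (-1 : ℝ) • EuclideanSpace.single (2 : Fin 3) (1 : ℝ)) R₂ᶜ :=
    starConvex_compl_axisRay x₀ (by norm_num)
  have hu₁ := exists_hasFDerivAt_innerSL_of_curl_eq_zero_of_starConvex ho₁ hst₁ (hW1.mono hR₁s)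
    fun z hz => hWcurl z (hR₁s hz)
  have hu₂ := exists_hasFDerivAt_innerSL_of_curl_eq_zero_of_starConvex ho₂ hst₂ (hW1.mono hR₂s)
    fun z hz => hWcurl z (hR₂s hz)
  have hconn : IsPreconnected (R₁ᶜ ∩ R₂ᶜ) := by
    rw [hR₁, hR₂, inter_compl_axisRay_eq x₀]
    exact isPreconnected_compl_axisLine x₀
  obtain ⟨φ, hφ'⟩ := exists_hasFDerivAt_of_union (A := fun z => innerSL ℝ (W z)) ho₁ ho₂ hconn hu₁ hu₂
  have hφ : ∀ x ∈ ({x₀}ᶜ : Set (EuclideanSpace ℝ (Fin 3))), HasFDerivAt φ (innerSL ℝ (W x)) x := fun x hx =>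
    hφ' x (mem_union_compl_axisRay hx)
  have hgrad : ∀ x, x ≠ x₀ → gradient φ x = W x := fun x hx => by
    have h : HasGradientAt φ (W x) x := by
      rw [hasGradientAt_iff_hasFDerivAt]
      exact hφ x hx
    exact h.gradient
  refine ⟨φ, contDiffOn_two_of_hasFDerivAt_innerSL hopen hW1 hφ, fun x hx => ?_, fun x hx => ?_⟩
  · rw [hgrad x hx, hW_def]
    simp
  · rw [laplacian_eq_divergence_of_hasFDerivAt_innerSL hopen hφ hx (hWd x hx), hW_def,
      divergence_sub_apply (hVd x) (hTyd x hx), hdiv x, divergence_smul_sub_const (hTd x hx)]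
    ring

end Summit.NavierStokesRegularity.NavierStokesRegularity.Theorems.PoloidalLiouville.CentreJet

end
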